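import Summits.BirchSwinnertonDyer.BirchSwinnertonDyer.Theorems.PrintX8SharpFlatMuDefect
import Summits.BirchSwinnertonDyer.BirchSwinnertonDyer.Theses.PrintX8
import HarnessLib

/-!
# Route `PrintX8`, crux `MuBoundSmallImageX8` (stmt-BirchSwinnertonDyer-20622) BY NAME from (a) the
# one-colour analytic rider, (b) `μ(X₀(E/ℚ_∞)) = 0` (Conjecture A's length form) — the route-decl GLUE of
# `Theorems/PrintX8SharpFlatMuTransfer.lean` / `PrintX8SharpFlatMuDefect.lean` (cell `bsd-print-x8`, seat p1
# gen 2; `--supports` 20622; theorems only; this file imports the route file, the two mathematics files do not)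

PARTITION (cell bsd-print-x8, leaf `ClassX8`; crux 20622 = the 61 small-image X8 cells): types-the-object-of;
closes NONE — each theorem is CONDITIONAL on a displayed class-wide input (the analytic rider per pair,
resp. `μ(X₀) = 0` per pair), the construction fact `Sprung2012.thm714seq_sharpFlatColemanKato_zeta`
(p543968) and the period fact at `3`; 0 cells move; beyond-print theorem: no. HONEST FRAMING: the rider
is the Perrin-Riou / Pollack expectation `μ(L^{♯/♭}_3(E)) = 0` (class-wide NOT in print; per pair a finite
Mazur–Tate certificate — planner evidence on 20622: 61/61 cells read `(μ♭, μ♯) = (0,0)` by one engine);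
`μ(X₀) = 0` is Coates–Sujatha's Conjecture A at `(E, 3)` (seat p2 g2's supply). Crux 20622 stays OPEN.

## Contents (BY-NAME closers of `Theses.PrintX8.MuBoundSmallImageX8`)
* `muBoundSmallImageX8_of_sharpFlatMuAn` — ⟸ the every-colour rider (`hμan`, text
  HOME/P1-SharpFlatMuAnSmallImageX8-signature.lean.txt) + `hCK` + `h3`;
* `muBoundSmallImageX8_of_oneColour_sharpFlatMuAn` — ⟸ the ONE-colour rider per pair (the planner's BC3
  stub shape `stub_muTransfer_of_oneColourMuZero` composed with `stub_oneColourMuZero`'s output) + `hCK` + `h3`;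
* `muBoundSmallImageX8_of_fine_lengthAt_eq_zero` — ⟸ «`length_(3) X₀(E/ℚ_∞) = 0` on the 61 cells» (LEMMA B;
  rider-free; the input of p2 g2's Conj-A road) + `hCK` + `h3`.

References: [Sprung2012] Def. 6.1, Thm. 7.14 (3), Prop. 7.19; [Kato2004Asterisque] Thm. 12.6, §13.8, §17.13;
[CoatesSujatha2005] Conj. A; tree: this seat's `PrintX8SharpFlatMuTransfer` (p545102), `PrintX8SharpFlatMuDefect`.
-/

set_option linter.dupNamespace false
set_option autoImplicit false

noncomputable section

open scoped Classical NumberField MatrixGroups ModularForm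

open NumberField IsDedekindDomain WeierstrassCurve CongruenceSubgroup Field
  Literature.NumberTheory.EllipticCurves Literature.NumberTheory.EllipticCurves.ModularForms
  Literature.NumberTheory.EllipticCurves.Rank1Residual
  Literature.NumberTheory.EllipticCurves.Sprung2017 Literature.NumberTheory.EllipticCurves.Sprung2012
  Literature.NumberTheory.EllipticCurves.GreenbergVatsal2000
  Literature.NumberTheory.EllipticCurves.ZpExtension Literature.NumberTheory.EllipticCurves.IwasawaAlgebra
  Summit.BirchSwinnertonDyer.BirchSwinnertonDyer.Theorems

namespace Summit.BirchSwinnertonDyer.BirchSwinnertonDyer.Theorems.PrintX8SharpFlatMuTransfer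

/-- **20622 ⟸ the every-colour analytic rider**, modulo `hCK` and the period fact at `3`: the crux
`MuBoundSmallImageX8` («`μ(X^•) ≤ μ(Λ/(L^•))` on the X8 pairs with `ρ̄_{E,3}` not onto and analytic rank
`≤ 1`») follows from `muBound_smallImageX8_of_sharpFlatMuAn` (μ-transfer: the rider for `•` gives
`μ(X^•) = 0`). NO K1; CONDITIONAL; closes nothing. [cite: Sprung2012, Def. 6.1 (p. 1495), Thm. 7.14 (3) (p. 1504)]
[cite: Kato2004Asterisque, Thm. 12.6 (p. 222), §13.8] -/
theorem muBoundSmallImageX8_of_sharpFlatMuAn (hCK : thm714seq_sharpFlatColemanKato_zeta)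
    (h3 : realPeriodRat_eq_unit_mul_plusPeriod_three)
    (hμan : ∀ (W : WeierstrassCurve ℚ) [W.IsElliptic] [W.IsGloballyMinimal] (p : ℕ) [Fact p.Prime],
        ClassX8 W p → ¬ Surj W p → ∀ (col : Chroma)
        (N : ℕ) (_ : NeZero N) (f : CuspForm (Gamma0 N) 2) (Lsharp Lflat : IwasawaAlgebra p),
        IsNewformOf W f → IsSprungPair f p (W.frobeniusTrace p) Lsharp Lflat →
        chromaticL col Lsharp Lflat ≠ 0 → HasUnitContent (chromaticL col Lsharp Lflat)) :
    Theses.PrintX8.MuBoundSmallImageX8 := by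
  intro W _ _ p _ hX hns hr col κ γ hκ hγ hγ' v hv g hg cneg c hH N hN f Lsharp Lflat hf hSP hcol D
  exact muBound_smallImageX8_of_sharpFlatMuAn hCK h3 hμan W p hX hns hr col κ γ hκ hγ hγ' v hv g hg cneg c
    hH N hN f Lsharp Lflat hf hSP hcol D

/-- **20622 ⟸ the ONE-colour analytic rider per pair** (the planner's BC3 stub shape: for every
small-image X8 pair of rank `≤ 1`, every newform and its Sprung pair, SOME colour `•₀` has a unit
coefficient ⟹ the `μ`-bound for EVERY colour with `L^• ≠ 0`), modulo `hCK` and the period fact at `3`: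
one colour's rider gives `length_(3) X₀(E/ℚ_∞) = 0` (reduction-free core), and LEMMA B gives the bound
for every colour. NO K1; CONDITIONAL; closes nothing. [cite: Sprung2012, Def. 6.1 (p. 1495), Prop. 7.19 (p. 1505)]
[cite: Kato2004Asterisque, Thm. 12.6 (p. 222), §13.8, §17.13 (p. 280)] -/
theorem muBoundSmallImageX8_of_oneColour_sharpFlatMuAn (hCK : thm714seq_sharpFlatColemanKato_zeta)
    (h3 : realPeriodRat_eq_unit_mul_plusPeriod_three)
    (hμ1 : ∀ (W : WeierstrassCurve ℚ) [W.IsElliptic] [W.IsGloballyMinimal] (p : ℕ) [Fact p.Prime],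
        ClassX8 W p → ¬ Surj W p → W.analyticRank ≤ 1 →
        ∀ (N : ℕ) (_ : NeZero N) (f : CuspForm (Gamma0 N) 2) (Lsharp Lflat : IwasawaAlgebra p),
        IsNewformOf W f → IsSprungPair f p (W.frobeniusTrace p) Lsharp Lflat →
        ∃ col₀ : Chroma, HasUnitContent (chromaticL col₀ Lsharp Lflat)) :
    Theses.PrintX8.MuBoundSmallImageX8 := by
  intro W _ _ p _ hX hns hr col κ γ hκ hγ hγ' v hv g hg cneg c hH N hN f Lsharp Lflat hf hSP hcol D
  haveI := hN
  obtain ⟨col₀, hu₀⟩ := hμ1 W p hX hns hr N hN f Lsharp Lflat hf hSP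
  -- a period ratio for `f` from the period fact at `3`
  have hp3 : p = 3 := hX.1
  subst hp3
  obtain ⟨u, hu1, hΩ⟩ := h3 W hX.2.1.1 (ClassX8.irr W 3 hX) f hf
  have hu0 : (u : ℝ) ≠ 0 := by
    intro h
    have h0 : u = 0 := by exact_mod_cast h
    rw [h0] at hu1
    simp at hu1
  have hϖ : ((u⁻¹ : ℚ) : ℝ) * W.realPeriodRat = plusPeriod f := by
    rw [hΩ, Rat.cast_inv, ← mul_assoc, inv_mul_cancel₀ hu0, one_mul]
  exact X8.sharpFlatMu_le_of_oneColour_hasUnitContent W 3 hCK h3 hX hns f hf u⁻¹ hϖ κ γ hκ hγ hγ' v hv g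
    hg cneg c hH hSP col₀ hu₀ col hcol D

/-- **20622 ⟸ «`length_(3) X₀(E/ℚ_∞) = 0` on the 61 small-image X8 pairs of rank `≤ 1`»** (Coates–Sujatha's
Conjecture A at `(E, 3)` in the tree's `lengthAt` currency, for every cyclotomic `(κ, γ)` matching the
cyclotomic variable and every dual fine Selmer datum), modulo `hCK` and the period fact at `3` — LEMMA B
class-wide, RIDER-FREE (the input of seat p2 g2's Conj-A road). NO K1; CONDITIONAL; closes nothing.
[cite: Sprung2012, Thm. 7.14 (3) (p. 1504) and Prop. 7.19 (p. 1505)] [cite: Kato2004Asterisque, §17.13 (p. 280)]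
[cite: CoatesSujatha2005, Conjecture A] -/
theorem muBoundSmallImageX8_of_fine_lengthAt_eq_zero (hCK : thm714seq_sharpFlatColemanKato_zeta)
    (h3 : realPeriodRat_eq_unit_mul_plusPeriod_three)
    (hA : ∀ (W : WeierstrassCurve ℚ) [W.IsElliptic] [W.IsGloballyMinimal] (p : ℕ) [Fact p.Prime],
        ClassX8 W p → ¬ Surj W p → W.analyticRank ≤ 1 →
        ∀ (κ : ZpExtension ℚ p) (γ : absoluteGaloisGroup ℚ),
          κ.IsCyclotomic → κ.IsTopGenerator γ → IsCyclotomicVariable p γ →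
        ∀ (Y : W.FineSelmerDualData κ γ) (𝔭 : PrimeSpectrum (IwasawaAlgebra p)),
          𝔭.asIdeal = IwasawaAlgebra.augIdealP p → Module.lengthAt (IwasawaAlgebra p) Y.X 𝔭 = 0) :
    Theses.PrintX8.MuBoundSmallImageX8 := by
  intro W _ _ p _ hX hns hr col κ γ hκ hγ hγ' v hv g hg cneg c hH N hN f Lsharp Lflat hf hSP hcol D
  haveI := hN
  have hp3 : p = 3 := hX.1
  subst hp3
  obtain ⟨u, hu1, hΩ⟩ := h3 W hX.2.1.1 (ClassX8.irr W 3 hX) f hf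
  have hu0 : (u : ℝ) ≠ 0 := by
    intro h
    have h0 : u = 0 := by exact_mod_cast h
    rw [h0] at hu1
    simp at hu1
  have hϖ : ((u⁻¹ : ℚ) : ℝ) * W.realPeriodRat = plusPeriod f := by
    rw [hΩ, Rat.cast_inv, ← mul_assoc, inv_mul_cancel₀ hu0, one_mul]
  exact X8.sharpFlatMu_le_of_fine_lengthAt_eq_zero W 3 hCK h3 hX f hf u⁻¹ hϖ κ γ hκ hγ hγ' v hv g hg cneg c
    hH col hSP hcol D (hA W 3 hX hns hr κ γ hκ hγ hγ')

end Summit.BirchSwinnertonDyer.BirchSwinnertonDyer.Theorems.PrintX8SharpFlatMuTransfer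

end
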